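import Summits.BirchSwinnertonDyer.BirchSwinnertonDyer.Theorems.ByReductionTypeAtTwoTowerClassKitD
import HarnessLib

/-!
# TOWER-road class instances — KIT, part E: the torsion-tolerant gap with the LOWER count in the
# `A_j[2]` currency (`#A_j[p] ≤ #ker h_j · #X/(p,T^{pʲ})X`), which on the INELIG block gains the bit of
# the kernel class (route ByReductionTypeAtTwo, items 19573 / 19271; seat bsd-2adic-ord-2 GEN 4)

HONEST FRAMING (cell `bsd-2adic`, run/shared/lean/pub/bsd-2adic/, HUMAN RULINGS D-0036 / D-0054 / D-0074):
THEOREMS ONLY; nothing asserted; no definition; no new named fact; closes nothing by itself.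

KitD / `…TowerLayerTorsion` bound the lower layer through the CLASSICAL count: `#Sel_{2^∞}(E/ℚ_j)[2] ≤
#ker h_j · #T_j`. On a curve with `E(ℚ)[2] ≅ ℤ/2` the group `A_0 = h_0⁻¹(Sel_∞)` is one bit larger than the
Selmer part (it contains `ker h_0 = H¹(Γ, E(ℚ_∞)[2^∞]) ≠ 0`, tower-eng's `e_0 = d_0 + 1` on the INELIG rows), and
the same counting gives the sharper **`#A_j[p] ≤ #ker h_j · #T_j`** (§1, `natCard_layerClasses_le_mul`: `A_j[p] ⊆ A′ =
h_j⁻¹(Sel_∞[p])` and `#A′ = #ker h_j · #T_j`). §2 turns it into the gap door with an `A`-currency lower count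
`2^a ≤ #A_j[2]` (`towerGapAtTwo_of_classCounts_of_torsion`, `…_zero`, `…_goodPrime_card`): certificate
`d + t + 1 ≤ 2^{j'} − 2^j + a` with `a = e_j − t_j` instead of `d_j − t_j`. Habitat (evidence tier, TABLE-TOWER-E1
@16f1b5fa230aec58, INELIG μ_an = 0 members, `(j,j') = (0,2)`, `t = 1`): 31 classes instead of 10.

References: [GreenbergLNM1716] §1 p. 60 and p. 62, §3 pp. 85–86, §4 Lemma 4.3; [Washington1997] §13.2.
-/

set_option autoImplicit false
-- the route's Theorems namespace repeats a component by design (summit = sub-problem, D-0017).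
set_option linter.dupNamespace false

noncomputable section

open scoped Classical

open WeierstrassCurve Literature.NumberTheory.EllipticCurves PowerSeries
  Summit.BirchSwinnertonDyer.Rank1Residual Summit.BirchSwinnertonDyer.Rank1Residual.X5.TowerGap

universe u

namespace Summit.BirchSwinnertonDyer.BirchSwinnertonDyer.Theorems.TowerLayer

/-! ## §1 `#A_n[p] ≤ #ker h_n · #T_n` -/

section Layer

variable {K : Type u} [Field K] [NumberField K] (W : WeierstrassCurve K) {p : ℕ}
  [hp : Fact p.Prime] (κ : ZpExtension K p)

/-- **`#A_n[p] ≤ #ker h_n · #T_n`** (`T_n = Sel_∞[p]^{γ^{pⁿ}}`, `ker h_n` and `T_n` finite): `h_n` carries `A_n[p]`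
into `T_n` with kernel inside `ker h_n`. [cite: GreenbergLNM1716, §3 pp. 85–86 (Lemmas 3.1, 3.2)] -/
theorem natCard_layerClasses_le_mul (γ : Field.absoluteGaloisGroup K) (n : ℕ)
    (hfin : Finite (W.layerToInfty κ n).ker)
    (hT : Finite {s : W.selmerInfty κ // p • s = 0 ∧
      W.conjH1 p κ.kerSubgroup (γ ^ p ^ n) (s : W.subgroupH1 p κ.kerSubgroup) = s}) :
    Nat.card {z : W.selmerInftyPreimage κ n // p • z = 0} ≤
      Nat.card (W.layerToInfty κ n).ker * Nat.card {s : W.selmerInfty κ // p • s = 0 ∧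
        W.conjH1 p κ.kerSubgroup (γ ^ p ^ n) (s : W.subgroupH1 p κ.kerSubgroup) = s} := by
  set L := W.subgroupH1 p (κ.layerSubgroup n) with hL
  set h := W.layerToInfty κ n with hh
  let S : AddSubgroup L := W.selmerInftyPreimage κ n ⊓ (DistribSMul.toAddMonoidHom L p).ker
  have hS : ∀ y : L, y ∈ S ↔ y ∈ W.selmerInftyPreimage κ n ∧ p • y = 0 := fun y ↦ by
    simp only [S, AddSubgroup.mem_inf, AddMonoidHom.mem_ker, DistribSMul.toAddMonoidHom_apply]
  have hSel : Nat.card {z : W.selmerInftyPreimage κ n // p • z = 0} = Nat.card S := by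
    let g : {z : W.selmerInftyPreimage κ n // p • z = 0} → S := fun z ↦ ⟨(z.1 : L), (hS _).mpr ⟨z.1.2, by
      rw [← AddSubgroup.coe_nsmul, z.2, AddSubgroup.coe_zero]⟩⟩
    refine Nat.card_congr (Equiv.ofBijective g ⟨?_, ?_⟩)
    · intro z z' hzz'
      have := congrArg (fun w : S ↦ (w : L)) hzz'
      exact Subtype.ext (Subtype.ext this)
    · rintro ⟨y, hy⟩
      obtain ⟨hy1, hy2⟩ := (hS y).mp hy
      exact ⟨⟨⟨y, hy1⟩, Subtype.ext (by rw [AddSubgroup.coe_nsmul, AddSubgroup.coe_zero]; exact hy2)⟩, rfl⟩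
  let ψ : S →+ W.subgroupH1 p κ.kerSubgroup := h.comp S.subtype
  have hψker : Nat.card ψ.ker ≤ Nat.card h.ker := by
    haveI := hfin
    refine Nat.card_le_card_of_injective (fun y : ψ.ker ↦ (⟨(y.1 : L), ?_⟩ : h.ker)) ?_
    · have := (AddMonoidHom.mem_ker).mp y.2
      rw [AddMonoidHom.mem_ker]
      simpa [ψ] using this
    · intro y y' hyy'
      have := congrArg (fun w : h.ker ↦ (w : L)) hyy'
      exact Subtype.ext (Subtype.ext this)
  have hψrange : Nat.card ψ.range ≤ Nat.card {s : W.selmerInfty κ // p • s = 0 ∧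
      W.conjH1 p κ.kerSubgroup (γ ^ p ^ n) (s : W.subgroupH1 p κ.kerSubgroup) = s} := by
    haveI := hT
    refine Nat.card_le_card_of_injective (fun x : ψ.range ↦ (⟨⟨x.1, ?_⟩, ?_, ?_⟩ : {s : W.selmerInfty κ //
      p • s = 0 ∧ W.conjH1 p κ.kerSubgroup (γ ^ p ^ n) (s : W.subgroupH1 p κ.kerSubgroup) = s})) ?_
    · obtain ⟨y, hy⟩ := x.2
      rw [← hy]
      exact (mem_selmerInftyPreimage_iff W κ n _).mp ((hS _).mp y.2).1
    · obtain ⟨y, hy⟩ := x.2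
      apply Subtype.ext
      rw [AddSubgroup.coe_nsmul, AddSubgroup.coe_mk, ← hy]
      change p • h (y : L) = 0
      rw [← map_nsmul, ((hS _).mp y.2).2, map_zero]
    · obtain ⟨y, hy⟩ := x.2
      rw [AddSubgroup.coe_mk, ← hy]
      exact conjH1_pow_layerToInfty W κ γ n (y : L)
    · intro x x' hxx'
      have := congrArg (fun s : {s : W.selmerInfty κ // p • s = 0 ∧
        W.conjH1 p κ.kerSubgroup (γ ^ p ^ n) (s : W.subgroupH1 p κ.kerSubgroup) = s} ↦
          ((s.1 : W.selmerInfty κ) : W.subgroupH1 p κ.kerSubgroup)) hxx'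
      exact Subtype.ext this
  rw [hSel, natCard_eq_natCard_ker_mul_natCard_range ψ]
  exact Nat.mul_le_mul hψker hψrange

end Layer

end Summit.BirchSwinnertonDyer.BirchSwinnertonDyer.Theorems.TowerLayer

/-! ## §2 The gap door with the lower count in the `A`-currency -/

namespace Summit.BirchSwinnertonDyer.BirchSwinnertonDyer.Theorems.TowerClass

open Summit.BirchSwinnertonDyer.Rank1Residual.X5.O1 Summit.BirchSwinnertonDyer.BirchSwinnertonDyer.Theorems

variable (W : WeierstrassCurve ℚ) [W.IsElliptic]

/-- **Tower gap with rational `2`-torsion allowed, `A`-currency lower count.** Granted the finiteness of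
`E(ℚ_∞)[2^∞]` (`hB`): `2^a ≤ #A_j[2]`, `#E[2^∞]^{Gal(ℚ̄/ℚ_j)} ≤ 2^t`, `#A_{j'}[2] ≤ 2^d` and
`d + t + 1 ≤ 2^{j'} − 2^j + a` ⇒ `O1.TowerGapAtTwo W` (`#X/(2,T^{2^j})X = #T_j ≥ #A_j[2]/#ker h_j ≥ 2^{a−t}`).
[cite: GreenbergLNM1716, §1 p. 60 and p. 62, §3 pp. 85–86, §4 Lemma 4.3] [cite: Washington1997, §13.2] -/
theorem towerGapAtTwo_of_classCounts_of_torsion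
    (hB : ∀ κ : ZpExtension ℚ 2, κ.IsCyclotomic →
      Finite (FixedPoints.addSubgroup κ.kerSubgroup (geomPrimaryTorsion W 2)))
    {j j' a d t : ℕ} (hjj' : j ≤ j')
    (hlow : ∀ κ : ZpExtension ℚ 2, κ.IsCyclotomic →
      2 ^ a ≤ Nat.card {z : W.selmerInftyPreimage κ j // 2 • z = 0})
    (htor : ∀ κ : ZpExtension ℚ 2, κ.IsCyclotomic →
      Nat.card {m : geomPrimaryTorsion W 2 | ∀ σ ∈ κ.layerSubgroup j, σ • m = m} ≤ 2 ^ t)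
    (hup : ∀ κ : ZpExtension ℚ 2, κ.IsCyclotomic →
      Nat.card {z : W.selmerInftyPreimage κ j' // 2 • z = 0} ≤ 2 ^ d)
    (had : d + t + 1 ≤ 2 ^ j' - 2 ^ j + a) : TowerGapAtTwo W := by
  intro κ γ hκ hγ _ D
  haveI : Module.Finite (IwasawaAlgebra 2) D.X := D.module_finite_holds hγ
  haveI := hB κ hκ
  have hfinj : Finite (W.layerToInfty κ j).ker := TowerLayer.finite_ker_layerToInfty W κ j
  have hfinj' : Finite (W.layerToInfty κ j').ker := TowerLayer.finite_ker_layerToInfty W κ j'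
  have hTj : Finite {s : W.selmerInfty κ // 2 • s = 0 ∧
      W.conjH1 2 κ.kerSubgroup (γ ^ 2 ^ j) (s : W.subgroupH1 2 κ.kerSubgroup) = s} :=
    TowerLayer.finite_fixedPTorsion D j
  refine ⟨2 ^ j, 2 ^ j' - 2 ^ j, ?_⟩
  rw [Nat.add_sub_cancel' (Nat.pow_le_pow_right (by norm_num) hjj')]
  have ej' : Nat.card (D.X ⧸ (towerIdeal 2 (2 ^ j') • ⊤ : Submodule (IwasawaAlgebra 2) D.X)) =
      Nat.card {s : W.selmerInfty κ // 2 • s = 0 ∧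
        W.conjH1 2 κ.kerSubgroup (γ ^ 2 ^ j') (s : W.subgroupH1 2 κ.kerSubgroup) = s} := by
    rw [← KatoHalfPinch.layerIdeal_eq_towerIdeal, TowerLayer.natCard_quotient_layerIdeal_eq D j']
  have ej : Nat.card (D.X ⧸ (towerIdeal 2 (2 ^ j) • ⊤ : Submodule (IwasawaAlgebra 2) D.X)) =
      Nat.card {s : W.selmerInfty κ // 2 • s = 0 ∧
        W.conjH1 2 κ.kerSubgroup (γ ^ 2 ^ j) (s : W.subgroupH1 2 κ.kerSubgroup) = s} := by
    rw [← KatoHalfPinch.layerIdeal_eq_towerIdeal, TowerLayer.natCard_quotient_layerIdeal_eq D j]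
  have hK : Nat.card (W.layerToInfty κ j).ker ≤ 2 ^ t := by
    rw [W.natCard_ker_layerToInfty_eq_natCard_fixedPoints κ j]; exact htor κ hκ
  have h1 : 2 ^ a ≤ 2 ^ t * Nat.card {s : W.selmerInfty κ // 2 • s = 0 ∧
      W.conjH1 2 κ.kerSubgroup (γ ^ 2 ^ j) (s : W.subgroupH1 2 κ.kerSubgroup) = s} :=
    (hlow κ hκ).trans ((TowerLayer.natCard_layerClasses_le_mul W κ γ j hfinj hTj).trans
      (Nat.mul_le_mul_right _ hK))
  rw [ej', ej]
  have key : 2 ^ t * 2 ^ d < 2 ^ t * (2 ^ (2 ^ j' - 2 ^ j) * Nat.card {s : W.selmerInfty κ // 2 • s = 0 ∧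
      W.conjH1 2 κ.kerSubgroup (γ ^ 2 ^ j) (s : W.subgroupH1 2 κ.kerSubgroup) = s}) :=
    calc 2 ^ t * 2 ^ d = 2 ^ (t + d) := (pow_add _ _ _).symm
      _ < 2 ^ (2 ^ j' - 2 ^ j + a) := Nat.pow_lt_pow_right (by norm_num) (by omega)
      _ = 2 ^ (2 ^ j' - 2 ^ j) * 2 ^ a := pow_add _ _ _
      _ ≤ 2 ^ (2 ^ j' - 2 ^ j) * (2 ^ t * Nat.card {s : W.selmerInfty κ // 2 • s = 0 ∧
          W.conjH1 2 κ.kerSubgroup (γ ^ 2 ^ j) (s : W.subgroupH1 2 κ.kerSubgroup) = s}) :=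
        Nat.mul_le_mul_left _ h1
      _ = 2 ^ t * (2 ^ (2 ^ j' - 2 ^ j) * Nat.card {s : W.selmerInfty κ // 2 • s = 0 ∧
          W.conjH1 2 κ.kerSubgroup (γ ^ 2 ^ j) (s : W.subgroupH1 2 κ.kerSubgroup) = s}) := by ring
  calc Nat.card {s : W.selmerInfty κ // 2 • s = 0 ∧
        W.conjH1 2 κ.kerSubgroup (γ ^ 2 ^ j') (s : W.subgroupH1 2 κ.kerSubgroup) = s}
      ≤ Nat.card {z : W.selmerInftyPreimage κ j' // 2 • z = 0} :=
        TowerLayer.natCard_fixedPTorsion_le_natCard_layerClasses_of_finite_ker W κ hγ j' hfinj'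
    _ ≤ 2 ^ d := hup κ hκ
    _ < _ := Nat.lt_of_mul_lt_mul_left key

/-- **The layer-`0` form with PRINT `hB` and the torsion certificate `#E[2^∞]^{Γ_ℚ} ≤ 2^t`.**
[cite: GreenbergLNM1716, §1 p. 60 and p. 62, §3 pp. 85–86, §4 Lemma 4.3] -/
theorem towerGapAtTwo_of_classCounts_of_torsion_zero
    (hB : Greenberg1999.finite_torsion_cyclotomicZpExtension) {j' a d t : ℕ}
    (hlow : ∀ κ : ZpExtension ℚ 2, κ.IsCyclotomic →
      2 ^ a ≤ Nat.card {z : W.selmerInftyPreimage κ 0 // 2 • z = 0})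
    (htor : Nat.card (MulAction.fixedPoints (Field.absoluteGaloisGroup ℚ) (geomPrimaryTorsion W 2)) ≤ 2 ^ t)
    (hup : ∀ κ : ZpExtension ℚ 2, κ.IsCyclotomic →
      Nat.card {z : W.selmerInftyPreimage κ j' // 2 • z = 0} ≤ 2 ^ d)
    (had : d + t + 1 ≤ 2 ^ j' - 1 + a) : TowerGapAtTwo W :=
  towerGapAtTwo_of_classCounts_of_torsion W (fun κ hκ ↦ hB W 2 κ hκ) (Nat.zero_le j') hlow
    (fun κ _ ↦ by rw [W.natCard_fixedBy_layerSubgroup_zero_eq κ]; exact htor) hup (by simpa using had)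

/-- **The layer-`0` form with the torsion certificate read off a good odd prime `ℓ`** (`#Ẽ(𝔽_ℓ) = n`,
`¬ 2^{t+1} ∣ n`). [cite: GreenbergLNM1716, §1 p. 60 and p. 62, §3 pp. 85–86, §4 Lemma 4.3]
[cite: SilvermanAEC2009, VII.3 Prop. 3.1(b)] -/
theorem towerGapAtTwo_of_classCounts_of_goodPrime_card [W.IsGloballyMinimal]
    (hB : Greenberg1999.finite_torsion_cyclotomicZpExtension) {j' a d t n : ℕ} (ℓ : ℕ) [Fact ℓ.Prime]
    (h3 : 3 ≤ ℓ) (hgood : W.HasGoodReductionAtPrime ℓ) (hn : W.reductionPointCount ℓ = n)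
    (hndvd : ¬ 2 ^ (t + 1) ∣ n)
    (hlow : ∀ κ : ZpExtension ℚ 2, κ.IsCyclotomic →
      2 ^ a ≤ Nat.card {z : W.selmerInftyPreimage κ 0 // 2 • z = 0})
    (hup : ∀ κ : ZpExtension ℚ 2, κ.IsCyclotomic →
      Nat.card {z : W.selmerInftyPreimage κ j' // 2 • z = 0} ≤ 2 ^ d)
    (had : d + t + 1 ≤ 2 ^ j' - 1 + a) : TowerGapAtTwo W := by
  haveI : NeZero ℓ := ⟨(Fact.out : ℓ.Prime).ne_zero⟩
  have hn0 : n ≠ 0 := hn ▸ (reductionPointCount_pos W ℓ).ne'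
  exact towerGapAtTwo_of_classCounts_of_torsion_zero W hB hlow
    (natCard_fixedPoints_geomPrimaryTorsion_le_pow_of_good W 2 ℓ h3 hgood
      (hn ▸ padicValNat_le_of_not_pow_succ_dvd hn0 hndvd)) hup had

end Summit.BirchSwinnertonDyer.BirchSwinnertonDyer.Theorems.TowerClass

end
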